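import Mathlib
import Literature.MathematicalPhysics.QuantumLattice.SchwingerOSAxioms
import HarnessLib

/-!
# Soft OS-assembly toolkit I: diagonal subsequences, `ε/3`, separability of Schwartz space for finite-order norms

Helper file for stub `stub_assembly` of crux `OSLegsFromFemtoAndGap` (stmt-QuantumFields-9367, line
`dlr-collar-transfer`; lead `prover-line-stmt-QuantumFields-9367-0`), reusable by every "lattice ⇒ OS data"
assembly of the sub-problem (HypercubicLimit `stub_lockedOSLimit`, ContinuumLimitOnTrajectory `stub_osLegs`, the
hankel-rope / rp-self-improving lines of 9367): the functional-analytic inputs of the COMPACTNESS step "k-uniform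
E0′-type bounds ⇒ a subsequence along which the lattice `n`-point distributions converge on `⁰𝒮`".

* `exists_strictMono_forall_tendsto` — Cantor's diagonal argument: countably many bounded complex sequences have
  a common convergent subsequence (Tychonoff + first countability of `ι → ℂ`).
* `tendsto_of_seminorm_dense` — `ε/3`: linear functionals uniformly bounded by a seminorm `p` on a submodule `M`
  that converge on a `p`-dense subset of `M` converge on all of `M`.
* `schwartz_exists_countable_seminorm_dense` — every subset of the Schwartz space `𝓢(X, ℂ)` (`X` a
  finite-dimensional real normed space) contains a countable subset dense for the finite-order Schwartz norm
  `schwartzNorm m` (jets up to order `m` embed into the second-countable space `C(Fin (m+1) × X × Xᵐ, ℂ)`; the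
  weight one order higher controls the tails `‖x‖ > R`).

The compactness theorem itself (`exists_subseq_clm_limit`, Hahn–Banach) is in the sequel file
`LangevinControlUVOSLegsFromFemtoAndGapStubAssemblyCompactness.lean`.

References: Osterwalder–Schrader 1975 §2 (E0′ and `⁰𝒮`); Glimm–Jaffe 1987 §6.1, §19.1 (compactness of Schwinger
functions from uniform bounds); Reed–Simon I, Thm. I.24 / §V.2 (diagonal trick, separability).
-/

noncomputable section

open scoped SchwartzMap Topology
open Filter Set MeasureTheory Literature.MathematicalPhysics.QuantumLattice

namespace Summit.QuantumFields.YangMills.Theorems.OSLegsFromFemtoAndGap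

/-! ### Cantor's diagonal argument -/

/-- **Diagonal subsequence.** Countably many bounded complex sequences `u j` admit ONE strictly increasing
`φ : ℕ → ℕ` along which every `u j ∘ φ` converges (Tychonoff for `Π j, closedBall 0 (B j)` and sequential
compactness of compact sets in the first-countable space `ι → ℂ`). [folklore] -/
theorem exists_strictMono_forall_tendsto {ι : Type*} [Countable ι] {u : ι → ℕ → ℂ}
    (hu : ∀ j, ∃ B : ℝ, ∀ k, ‖u j k‖ ≤ B) :
    ∃ φ : ℕ → ℕ, StrictMono φ ∧ ∀ j, ∃ c : ℂ, Tendsto (fun k => u j (φ k)) atTop (𝓝 c) := by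
  choose B hB using hu
  set s : Set (ι → ℂ) := Set.pi Set.univ fun j => Metric.closedBall (0 : ℂ) (B j) with hs
  have hsc : IsCompact s := isCompact_univ_pi fun j => isCompact_closedBall _ _
  have hx : ∀ k, (fun j => u j k) ∈ s := fun k => by
    simp only [hs, Set.mem_pi, Set.mem_univ, true_implies, Metric.mem_closedBall, dist_zero_right]
    exact fun j => hB j k
  obtain ⟨a, -, φ, hφ, hlim⟩ := hsc.tendsto_subseq hx
  refine ⟨φ, hφ, fun j => ⟨a j, ?_⟩⟩
  have := (tendsto_pi_nhds.1 hlim) j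
  simpa [Function.comp] using this

/-! ### `ε / 3` -/

/-- **`ε/3` lemma.** Let `T k` be linear functionals on a complex vector space, bounded on the submodule `M`
by the seminorm `p` uniformly in `k`, and convergent on a subset `D ⊆ M` that is `p`-dense in `M`. Then `T k v`
converges for every `v ∈ M`. [folklore] -/
theorem tendsto_of_seminorm_dense {V : Type*} [AddCommGroup V] [Module ℂ V] (p : Seminorm ℂ V)
    (M : Submodule ℂ V) (T : ℕ → V →ₗ[ℂ] ℂ) (hT : ∀ k, ∀ v ∈ M, ‖T k v‖ ≤ p v)
    (D : Set V) (hDM : D ⊆ M) (hdense : ∀ v ∈ M, ∀ ε > 0, ∃ d ∈ D, p (v - d) < ε)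
    (hconv : ∀ d ∈ D, ∃ c : ℂ, Tendsto (fun k => T k d) atTop (𝓝 c)) :
    ∀ v ∈ M, ∃ c : ℂ, Tendsto (fun k => T k v) atTop (𝓝 c) := by
  intro v hv
  have hcs : CauchySeq fun k => T k v := by
    refine Metric.cauchySeq_iff.2 fun ε hε => ?_
    obtain ⟨d, hd, hvd⟩ := hdense v hv (ε / 3) (by positivity)
    obtain ⟨c, hc⟩ := hconv d hd
    obtain ⟨N, hN⟩ := Metric.cauchySeq_iff.1 hc.cauchySeq (ε / 3) (by positivity)
    refine ⟨N, fun m hm n hn => ?_⟩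
    have hvdM : v - d ∈ M := M.sub_mem hv (hDM hd)
    have h1 : ‖T m (v - d)‖ ≤ p (v - d) := hT m _ hvdM
    have h2 : ‖T n (v - d)‖ ≤ p (v - d) := hT n _ hvdM
    have h3 := hN m hm n hn
    rw [dist_eq_norm] at h3 ⊢
    have hsplit : T m v - T n v = T m (v - d) + (T m d - T n d) - T n (v - d) := by
      simp only [map_sub]; ring
    calc ‖T m v - T n v‖ = ‖T m (v - d) + (T m d - T n d) - T n (v - d)‖ := by rw [hsplit]
      _ ≤ ‖T m (v - d)‖ + ‖T m d - T n d‖ + ‖T n (v - d)‖ := norm_sub_le_of_le (norm_add_le _ _) le_rfl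
      _ < ε / 3 + ε / 3 + ε / 3 := by gcongr <;> linarith
      _ = ε := by ring
  exact cauchySeq_tendsto_of_complete hcs


/-! ### Separability of Schwartz space for the finite-order norms `schwartzNorm m` -/

section Separable

variable {X : Type*} [NormedAddCommGroup X] [NormedSpace ℝ X] [FiniteDimensional ℝ X]

omit [FiniteDimensional ℝ X] in
/-- The scalar jet `(l, x, v) ↦ D^l F(x)(v₀, …, v_{l-1})` of a Schwartz function is continuous on
`Fin (m+1) × X × Xᵐ`. [folklore] -/
theorem continuous_scalarJet (m : ℕ) (F : 𝓢(X, ℂ)) :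
    Continuous fun p : Fin (m + 1) × X × (Fin m → X) =>
      iteratedFDeriv ℝ p.1 (F : X → ℂ) p.2.1 (fun i => p.2.2 (Fin.castLE (Nat.lt_succ_iff.mp p.1.isLt) i)) := by
  apply continuous_prod_of_discrete_left.2
  intro l
  have hD : Continuous fun q : X × (Fin m → X) => iteratedFDeriv ℝ (l : ℕ) (F : X → ℂ) q.1 :=
    ((F.smooth ⊤).continuous_iteratedFDeriv (by exact_mod_cast le_top)).comp continuous_fst
  have hv : Continuous fun q : X × (Fin m → X) =>
      (fun i : Fin l => q.2 (Fin.castLE (Nat.lt_succ_iff.mp l.isLt) i)) :=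
    continuous_pi fun i => (continuous_apply _).comp continuous_snd
  exact continuous_eval.comp (hD.prodMk hv)

omit [FiniteDimensional ℝ X] in
/-- From uniform closeness of the scalar jets on `closedBall 0 R × closedBall 0 1` (vectors padded by zeros) to
closeness of the iterated derivatives in operator norm on `closedBall 0 R` (shell argument, constant `2^l`). [folklore] -/
theorem norm_iteratedFDeriv_sub_le_of_jet {m : ℕ} {F G : 𝓢(X, ℂ)} {R ε' : ℝ} (hε' : 0 ≤ ε')
    (h : ∀ (l : Fin (m + 1)) (x : X) (v : Fin m → X), ‖x‖ ≤ R → ‖v‖ ≤ 1 →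
      ‖iteratedFDeriv ℝ l (F : X → ℂ) x (fun i => v (Fin.castLE (Nat.lt_succ_iff.mp l.isLt) i)) -
        iteratedFDeriv ℝ l (G : X → ℂ) x (fun i => v (Fin.castLE (Nat.lt_succ_iff.mp l.isLt) i))‖ ≤ ε')
    {l : ℕ} (hl : l ≤ m) {x : X} (hx : ‖x‖ ≤ R) :
    ‖iteratedFDeriv ℝ l (⇑(F - G)) x‖ ≤ 2 ^ l * ε' := by
  have hcoe : (⇑(F - G) : X → ℂ) = ⇑F - ⇑G := by ext y; simp
  have hFG : iteratedFDeriv ℝ l (⇑(F - G)) x = iteratedFDeriv ℝ l (F : X → ℂ) x - iteratedFDeriv ℝ l (G : X → ℂ) x := by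
    rw [hcoe]
    exact iteratedFDeriv_sub_apply (𝕜 := ℝ) (i := l) (f := (F : X → ℂ)) (g := (G : X → ℂ)) (x := x)
      ((F.smooth ⊤).contDiffAt.of_le (by exact_mod_cast le_top))
      ((G.smooth ⊤).contDiffAt.of_le (by exact_mod_cast le_top))
  rw [hFG]
  set D := iteratedFDeriv ℝ l (F : X → ℂ) x - iteratedFDeriv ℝ l (G : X → ℂ) x with hDdef
  refine ContinuousMultilinearMap.opNorm_le_bound (by positivity) fun w => ?_
  -- shell argument with `c i = 2`, `ε i = 1`
  have key := MultilinearMap.bound_of_shell_of_continuous D.toMultilinearMap D.cont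
    (ε := fun _ => (1 : ℝ)) (C := 2 ^ l * ε') (c := fun _ => (2 : ℝ)) (fun _ => one_pos)
    (fun _ => by norm_num) ?_ w
  · simpa using key
  intro u hlo hhi
  have hnorm2 : ∀ i, (1 : ℝ) / 2 ≤ ‖u i‖ := fun i => by simpa using hlo i
  -- pad `u` by zeros to an `m`-tuple of norm `≤ 1`
  let l' : Fin (m + 1) := ⟨l, Nat.lt_succ_of_le hl⟩
  let pad : Fin m → X := fun i => if h : (i : ℕ) < l then u ⟨i, h⟩ else 0
  have hpad1 : ‖pad‖ ≤ 1 := by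
    refine (pi_norm_le_iff_of_nonneg zero_le_one).2 fun i => ?_
    simp only [pad]
    split_ifs with h
    · exact (hhi _).le
    · simp
  have hpadu : (fun i : Fin l => pad (Fin.castLE (Nat.lt_succ_iff.mp l'.isLt) i)) = u := by
    funext i
    simp [pad, i.isLt]
  have h1 := h l' x pad hx hpad1
  simp only [l'] at hpadu h1
  rw [hpadu] at h1
  have hDu : ‖D u‖ ≤ ε' := by
    simpa [hDdef] using h1
  -- `∏ ‖u i‖ ≥ (1/2)^l`
  have hprod : ((1 : ℝ) / 2) ^ l ≤ ∏ i, ‖u i‖ := by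
    calc ((1 : ℝ) / 2) ^ l = ∏ _i : Fin l, (1 / 2 : ℝ) := by simp
      _ ≤ ∏ i, ‖u i‖ := Finset.prod_le_prod (fun _ _ => by norm_num) fun i _ => hnorm2 i
  calc ‖D.toMultilinearMap u‖ = ‖D u‖ := rfl
    _ ≤ ε' := hDu
    _ = 2 ^ l * ε' * (1 / 2) ^ l := by
        rw [mul_comm (2 ^ l) ε', mul_assoc, ← mul_pow]; norm_num
    _ ≤ 2 ^ l * ε' * ∏ i, ‖u i‖ := by gcongr

/-- **Separability of Schwartz space for `schwartzNorm m`.** For every `m` and every subset `A` of `𝓢(X, ℂ)`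
(`X` finite-dimensional) there is a countable `D ⊆ A` which is dense in `A` for the Schwartz norm of order `m`.
Proof: split `A` by the level `j` of the norm of order `m + 1`; on each level the jets of order `≤ m` form a
subset of the second-countable space `C(Fin (m+1) × X × Xᵐ, ℂ)` (compact-open topology), hence contain a
countable subset dense for uniform convergence on compacts; the extra weight controls `‖x‖ > R`. [folklore] -/
theorem schwartz_exists_countable_seminorm_dense (m : ℕ) (A : Set 𝓢(X, ℂ)) :
    ∃ D ⊆ A, D.Countable ∧ ∀ F ∈ A, ∀ ε > 0, ∃ G ∈ D, schwartzNorm m (F - G) < ε := by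
  classical
  -- level sets of the norm of order `m + 1`
  set lev : ℕ → Set 𝓢(X, ℂ) := fun j => {F ∈ A | schwartzNorm (m + 1) F ≤ j} with hlev
  -- the jet map into the second-countable space `C(Fin (m+1) × X × Xᵐ, ℂ)` (compact-open topology)
  let J : 𝓢(X, ℂ) → C(Fin (m + 1) × X × (Fin m → X), ℂ) := fun F => ⟨_, continuous_scalarJet m F⟩
  have hJ : ∀ (F : 𝓢(X, ℂ)) (l : Fin (m + 1)) (x : X) (v : Fin m → X), J F (l, x, v) =
      iteratedFDeriv ℝ l (F : X → ℂ) x (fun i => v (Fin.castLE (Nat.lt_succ_iff.mp l.isLt) i)) :=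
    fun _ _ _ _ => rfl
  -- for each level, a countable subset whose jets are dense in the jets of the level
  have hZ : ∀ j : ℕ, ∃ D ⊆ lev j, D.Countable ∧ ∀ F ∈ lev j, ∀ U ∈ 𝓝 (J F),
      ∃ G ∈ D, J G ∈ U := by
    intro j
    set S : Set C(Fin (m + 1) × X × (Fin m → X), ℂ) := J '' lev j with hS
    haveI : TopologicalSpace.SeparableSpace S := inferInstance
    obtain ⟨T, hTc, hTd⟩ := TopologicalSpace.exists_countable_dense S
    -- preimages in the level
    have hpre : ∀ t : S, ∃ F ∈ lev j, J F = (t : C(Fin (m + 1) × X × (Fin m → X), ℂ)) := fun t => by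
      obtain ⟨F, hF, hFt⟩ := (Set.mem_image _ _ _).1 t.2
      exact ⟨F, hF, hFt⟩
    choose pre hpre_mem hpre_eq using hpre
    refine ⟨pre '' T, ?_, hTc.image _, ?_⟩
    · rintro _ ⟨t, -, rfl⟩; exact hpre_mem t
    · intro F hF U hU
      have hFS : J F ∈ S := Set.mem_image_of_mem _ hF
      -- the neighbourhood pulled back to the subtype meets the dense set
      have hU' : Subtype.val ⁻¹' U ∈ 𝓝 (⟨J F, hFS⟩ : S) :=
        continuous_subtype_val.continuousAt.preimage_mem_nhds hU
      obtain ⟨t, htT, htU⟩ := hTd.inter_nhds_nonempty hU'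
      exact ⟨pre t, Set.mem_image_of_mem _ htT, by rw [hpre_eq t]; exact htU⟩
  choose D hDsub hDc hDd using hZ
  refine ⟨⋃ j, D j, Set.iUnion_subset fun j => (hDsub j).trans fun F hF => hF.1,
    Set.countable_iUnion hDc, ?_⟩
  intro F hF ε hε
  -- the level of `F`
  obtain ⟨j, hj⟩ := exists_nat_ge (schwartzNorm (m + 1) F)
  have hFlev : F ∈ lev j := ⟨hF, hj⟩
  -- radii
  have hj0 : (0 : ℝ) ≤ j := Nat.cast_nonneg j
  set R : ℝ := max 1 (8 * j / ε) with hR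
  have hR1 : 1 ≤ R := le_max_left _ _
  have hR0 : 0 < R := lt_of_lt_of_le one_pos hR1
  set ε' : ℝ := ε / (8 * 2 ^ m * R ^ m) with hε'
  have hε'0 : 0 < ε' := by positivity
  -- the compact-open neighbourhood: jets uniformly `ε'`-close on `univ × closedBall 0 R × closedBall 0 1`
  set K : Set (Fin (m + 1) × X × (Fin m → X)) :=
    Set.univ ×ˢ (Metric.closedBall (0 : X) R ×ˢ Metric.closedBall (0 : Fin m → X) 1) with hK
  have hKc : IsCompact K :=
    isCompact_univ.prod ((isCompact_closedBall _ _).prod (isCompact_closedBall _ _))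
  set W : Set (C(Fin (m + 1) × X × (Fin m → X), ℂ) × C(Fin (m + 1) × X × (Fin m → X), ℂ)) :=
    {fg | ∀ y ∈ K, (fg.1 y, fg.2 y) ∈ {ab : ℂ × ℂ | dist ab.1 ab.2 < ε'}} with hW
  have hWu : W ∈ uniformity C(Fin (m + 1) × X × (Fin m → X), ℂ) :=
    ContinuousMap.hasBasis_compactConvergenceUniformity.mem_of_mem
      (i := (K, {ab : ℂ × ℂ | dist ab.1 ab.2 < ε'})) ⟨hKc, Metric.dist_mem_uniformity hε'0⟩
  have hUn : UniformSpace.ball (J F) W ∈ 𝓝 (J F) := UniformSpace.ball_mem_nhds _ hWu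
  obtain ⟨G, hGD, hGU⟩ := hDd j F hFlev _ hUn
  refine ⟨G, Set.mem_iUnion.2 ⟨j, hGD⟩, ?_⟩
  have hGlev : G ∈ lev j := hDsub j hGD
  -- pointwise jet closeness
  have hjet : ∀ (l : Fin (m + 1)) (x : X) (v : Fin m → X), ‖x‖ ≤ R → ‖v‖ ≤ 1 →
      ‖iteratedFDeriv ℝ l (F : X → ℂ) x (fun i => v (Fin.castLE (Nat.lt_succ_iff.mp l.isLt) i)) -
        iteratedFDeriv ℝ l (G : X → ℂ) x (fun i => v (Fin.castLE (Nat.lt_succ_iff.mp l.isLt) i))‖ ≤ ε' := by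
    intro l x v hx hv
    have hy : ((l, x, v) : Fin (m + 1) × X × (Fin m → X)) ∈ K := by
      simp [hK, hx, hv]
    have := hGU (l, x, v) hy
    simp only [Set.mem_setOf_eq] at this
    rw [dist_eq_norm, hJ, hJ] at this
    exact this.le
  -- the bound on every Schwartz seminorm of order `≤ m`
  have hbound : ∀ k l : ℕ, k ≤ m → l ≤ m →
      SchwartzMap.seminorm ℂ k l (F - G) ≤ ε / 2 := by
    intro k l hk hl
    refine SchwartzMap.seminorm_le_bound ℂ k l (F - G) (by positivity) fun x => ?_
    by_cases hx : ‖x‖ ≤ R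
    · -- inside the ball: jets are close
      have h1 := norm_iteratedFDeriv_sub_le_of_jet hε'0.le hjet hl hx
      have hxk : ‖x‖ ^ k ≤ R ^ m := by
        calc ‖x‖ ^ k ≤ R ^ k := pow_le_pow_left₀ (norm_nonneg _) hx k
          _ ≤ R ^ m := pow_le_pow_right₀ hR1 hk
      have h2l : (2 : ℝ) ^ l ≤ 2 ^ m := pow_le_pow_right₀ (by norm_num) hl
      calc ‖x‖ ^ k * ‖iteratedFDeriv ℝ l (⇑(F - G)) x‖ ≤ R ^ m * (2 ^ l * ε') := by gcongr
        _ ≤ R ^ m * (2 ^ m * ε') := by gcongr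
        _ = ε / 8 := by rw [hε']; field_simp
        _ ≤ ε / 2 := by linarith
    · -- outside the ball: the weight one order higher
      push Not at hx
      have hxpos : 0 < ‖x‖ := hR0.trans hx
      have hcoe : (⇑(F - G) : X → ℂ) = ⇑F - ⇑G := by ext y; simp
      have hFG : iteratedFDeriv ℝ l (⇑(F - G)) x =
          iteratedFDeriv ℝ l (F : X → ℂ) x - iteratedFDeriv ℝ l (G : X → ℂ) x := by
        rw [hcoe]
        exact iteratedFDeriv_sub_apply (𝕜 := ℝ) (i := l) (f := (F : X → ℂ)) (g := (G : X → ℂ)) (x := x)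
          ((F.smooth ⊤).contDiffAt.of_le (by exact_mod_cast le_top))
          ((G.smooth ⊤).contDiffAt.of_le (by exact_mod_cast le_top))
      have hFb : ‖x‖ ^ (k + 1) * ‖iteratedFDeriv ℝ l (F : X → ℂ) x‖ ≤ j :=
        (SchwartzMap.le_seminorm ℂ (k + 1) l F x).trans
          ((seminorm_le_schwartzNorm (by omega) (by omega) F).trans hFlev.2)
      have hGb : ‖x‖ ^ (k + 1) * ‖iteratedFDeriv ℝ l (G : X → ℂ) x‖ ≤ j :=
        (SchwartzMap.le_seminorm ℂ (k + 1) l G x).trans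
          ((seminorm_le_schwartzNorm (by omega) (by omega) G).trans hGlev.2)
      have hsum : ‖x‖ ^ (k + 1) * ‖iteratedFDeriv ℝ l (⇑(F - G)) x‖ ≤ 2 * j := by
        rw [hFG]
        calc ‖x‖ ^ (k + 1) * ‖iteratedFDeriv ℝ l (F : X → ℂ) x - iteratedFDeriv ℝ l (G : X → ℂ) x‖
            ≤ ‖x‖ ^ (k + 1) * (‖iteratedFDeriv ℝ l (F : X → ℂ) x‖ + ‖iteratedFDeriv ℝ l (G : X → ℂ) x‖) := by
              gcongr; exact norm_sub_le _ _
          _ ≤ 2 * j := by rw [mul_add]; linarith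
      -- divide by `‖x‖ > R ≥ 8 j / ε`
      have hRj : 8 * j / ε ≤ R := le_max_right _ _
      have hkey : ‖x‖ ^ k * ‖iteratedFDeriv ℝ l (⇑(F - G)) x‖ * ‖x‖ ≤ 2 * j := by
        calc ‖x‖ ^ k * ‖iteratedFDeriv ℝ l (⇑(F - G)) x‖ * ‖x‖
            = ‖x‖ ^ (k + 1) * ‖iteratedFDeriv ℝ l (⇑(F - G)) x‖ := by ring
          _ ≤ 2 * j := hsum
      have hxR : 8 * j / ε < ‖x‖ := lt_of_le_of_lt hRj hx
      by_cases hj' : j = 0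
      · subst hj'
        have hle0 : ‖x‖ ^ k * ‖iteratedFDeriv ℝ l (⇑(F - G)) x‖ * ‖x‖ ≤ 0 := by simpa using hkey
        have h0 : ‖x‖ ^ k * ‖iteratedFDeriv ℝ l (⇑(F - G)) x‖ ≤ 0 := by
          by_contra hcon
          push Not at hcon
          have := mul_pos hcon hxpos
          linarith
        linarith [h0]
      · have hjpos : (0 : ℝ) < j := by positivity
        -- `‖x‖ > 8 j / ε` gives `2 j / ‖x‖ < ε / 4`
        have h8 : 2 * (j : ℝ) < ε / 4 * ‖x‖ := by
          have := mul_lt_mul_of_pos_left hxR (by positivity : (0 : ℝ) < ε / 4)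
          calc 2 * (j : ℝ) = ε / 4 * (8 * j / ε) := by field_simp; ring
            _ < ε / 4 * ‖x‖ := this
        have : ‖x‖ ^ k * ‖iteratedFDeriv ℝ l (⇑(F - G)) x‖ * ‖x‖ < ε / 4 * ‖x‖ := lt_of_le_of_lt hkey h8
        have := lt_of_mul_lt_mul_right this hxpos.le
        linarith
  -- conclude on the finite sup
  have hlt : schwartzNorm m (F - G) < ε := by
    unfold schwartzNorm
    refine Seminorm.finset_sup_apply_lt hε fun kl hkl => ?_
    rw [Finset.mem_Iic] at hkl
    rw [SchwartzMap.schwartzSeminormFamily_apply]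
    exact lt_of_le_of_lt (hbound kl.1 kl.2 hkl.1 hkl.2) (by linarith)
  exact hlt

end Separable

end Summit.QuantumFields.YangMills.Theorems.OSLegsFromFemtoAndGap

end
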